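import Summits.CriticalPhenomena.PercolationContinuityZ3.Theorems.TransplantHeisenbergZ2
import Literature.Probability.RandomPlanarGeometry.PlaneNonIntersectionProofs
import HarnessLib
import HarnessLib.Audit.Tags

/-!
# `H₃(ℤ) × ℤ²` (rung R2c, `X = Cay(H₃(ℤ))`): tubes and cell-slabs are strictly subcritical at `p_c`;
# the Kozma–Nitzan assembly of the rung

Builds on p205010 (kernel theorem, internal audit signed; external expert review pending).  Lane
`prim-bschramm` (memo `run/shared/lean/prim/bschramm/P3-NILPOTENT.md` v2 §10; LADDER R2c).  Sequel of
`TransplantHeisenbergZ2.lean`.  PROVED, both by the quotient–slab criterion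
`QuotientSlab.criticalProb_lt_criticalProb_induce_of_quotient` (p208012):

* **tubes are strictly subcritical at `p_c(G₂)`** (`criticalProb_lt_criticalProb_tube`): for every `ℓ`,
  `p_c(G₂) < p_c(G₂[H₃ × {|u₀| ≤ ℓ}])` (`Γ = ⟨(2ℓ+2)e₀⟩` on the `ℤ²` factor) — the device by which R2c makes
  transversal exits negligible AT `p = p_c(G₂)`;
* **cell-slabs are strictly subcritical at `p_c(G₂)`** (`criticalProb_lt_criticalProb_cellSlab`): for every
  `R, R'`, `p_c(G₂) < p_c(G₂[B_{R,R'} × ℤ²])`, `B_{R,R'} = {|a|,|b| ≤ R, |c| ≤ R'}` (central `Γ = ⟨C^M⟩`,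
  `M = R + 2R' + 1`) — link (D5) of the `θ(p_c) = 0` chain on this rung — whence
  `theta_cellSlab_criticalProb_eq_zero`;
* the KN Theorem 6 assembly `continuity_of_cellSlabPercolation : HeisenbergZ2CellSlabPercolation →
  HeisenbergZ2CriticalContinuity`: on this rung `θ(p_c) = 0` is EXACTLY the same-`p` statement "an
  infinite cluster at `p` forces some cell-slab to percolate at `p`" (KN §4 with `X`-thick cells on the
  `ℤ²` macro-lattice, interface (I-c) of the lane).
[cite: MartineauSevero2019, Cor. 2.2] [cite: KozmaNitzan2024, Thm. 6 and §4] [cite: BenjaminiSchramm1996, Conj. 4]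
-/

noncomputable section

namespace Summit.CriticalPhenomena.PercolationContinuityZ3.Theorems.HeisenbergZ2

open MeasureTheory Literature.Probability.Percolation Literature.Probability.LatticeModels
open Literature.Barriers.CriticalPhenomena (IsGraphTransitive IsQuasiTransitive)
open Summit.CriticalPhenomena.PercolationContinuityZ3.Theorems.Heisenberg

/-! ## Coordinate bounds along edges -/

/-- Along an edge of `Cay(H₃)` the coordinate `c` moves by at most `|a|` (`·A^±` keep `c`, `·B^±` shift it
by `±a`). [folklore] -/
theorem heis_adj_abs_sub_two_le {x z : HV} (h : heisenbergGraph.Adj x z) : |z 2 - x 2| ≤ |x 0| := by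
  rw [heisenbergGraph_adj] at h
  obtain ⟨-, (h | h) | (h | h)⟩ := h
  · subst h; simp [heisMul, genA]
  · subst h; simp [heisMul, genB]
  · rw [h]
    simp [heisMul, genA]
  · rw [h]
    have e : z 2 - heisMul z genB 2 = -(heisMul z genB 0) := by simp [heisMul, genB]
    rw [e, abs_neg]

/-! ## The two sub-structures: tubes and cell-slabs -/

/-- The tube `H₃ × {|u₀| ≤ ℓ}` (all of `X`, a strip of the plane). [folklore] -/
def tube (ℓ : ℕ) : Set HV2 := {x | |x.2 0| ≤ ℓ}

/-- The cell-slab `B_{R,R'} × ℤ²`, `B_{R,R'} = {|a| ≤ R, |b| ≤ R, |c| ≤ R'}` (an `X`-box times the whole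
macro-plane). [folklore] -/
def cellSlab (R R' : ℕ) : Set HV2 := {x | |x.1 0| ≤ R ∧ |x.1 1| ≤ R ∧ |x.1 2| ≤ R'}

/-- `0 ∈ tube ℓ`. [folklore] -/
theorem zero_mem_tube (ℓ : ℕ) : ((0 : HV), (0 : Site 2)) ∈ tube ℓ := by simp [tube]

/-- `0 ∈ cellSlab R R'`. [folklore] -/
theorem zero_mem_cellSlab (R R' : ℕ) : ((0 : HV), (0 : Site 2)) ∈ cellSlab R R' := by simp [cellSlab]

/-- An integer multiple `M·e` with `|M·e| ≤ K < M` vanishes. [folklore] -/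
theorem exp_eq_zero_of_abs_mul_le {M K : ℕ} (hKM : K < M) {e : ℤ} (h : |(M : ℤ) * e| ≤ K) : e = 0 := by
  by_contra hne
  have h1 : 1 ≤ |e| := Int.one_le_abs hne
  have : (M : ℤ) ≤ |(M : ℤ) * e| := by
    rw [abs_mul, Nat.abs_cast]; exact le_mul_of_one_le_right (by positivity) h1
  have hKM' : (K : ℤ) < M := by exact_mod_cast hKM
  linarith

/-- (i) for tubes: `x, g•x ∈ tube ℓ ⇒ g = 1` once `M > 2ℓ`. [folklore] -/
theorem tube_orbit_once {M ℓ : ℕ} (hM : 2 * ℓ < M) (g : TShift M) (x : HV2) (hx : x ∈ tube ℓ)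
    (hgx : g • x ∈ tube ℓ) : g = 1 := by
  simp only [tube, Set.mem_setOf_eq, TShift.smul_def, Pi.add_apply, Pi.single_eq_same] at hx hgx
  have hb : |(M : ℤ) * g.exp| ≤ (2 * ℓ : ℕ) := by
    have e : (M : ℤ) * g.exp = (x.2 0 + M * g.exp) - x.2 0 := by ring
    rw [e]; push_cast
    exact (abs_sub _ _).trans (by linarith)
  exact TShift.exp_injective (by simpa using exp_eq_zero_of_abs_mul_le hM hb)

/-- (ii) for tubes: no edge from the tube to a non-trivial translate, once `M > 2ℓ + 1`. [folklore] -/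
theorem tube_no_edge {M ℓ : ℕ} (hM : 2 * ℓ + 1 < M) (g : TShift M) (x y : HV2) (hx : x ∈ tube ℓ)
    (hy : y ∈ tube ℓ) (h : heisenbergZ2Graph.Adj x (g • y)) : g = 1 := by
  simp only [tube, Set.mem_setOf_eq] at hx hy
  rw [hz2_adj, TShift.smul_def] at h
  have hb : |(M : ℤ) * g.exp| ≤ (2 * ℓ + 1 : ℕ) := by
    rcases h with ⟨-, hu⟩ | ⟨hu, -⟩
    · have hu0 := congrFun hu 0
      simp only [Pi.add_apply, Pi.single_eq_same] at hu0
      have e : (M : ℤ) * g.exp = x.2 0 - y.2 0 := by linarith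
      rw [e]; push_cast
      exact (abs_sub _ _).trans (by linarith)
    · have h1 := Literature.Probability.RandomPlanarGeometry.PlaneNonIntersection.abs_sub_le_one_of_adj hu 0
      simp only [Pi.add_apply, Pi.single_eq_same] at h1
      have e : (M : ℤ) * g.exp = (y.2 0 + M * g.exp - x.2 0) + (x.2 0 - y.2 0) := by ring
      rw [e]; push_cast
      refine (abs_add_le _ _).trans ?_
      have := abs_sub (x.2 0) (y.2 0)
      linarith
  exact TShift.exp_injective (by simpa using exp_eq_zero_of_abs_mul_le hM hb)

/-- (i) for cell-slabs: once `M > 2R'`. [folklore] -/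
theorem cellSlab_orbit_once {M R R' : ℕ} (hM : 2 * R' < M) (g : CShift M) (x : HV2)
    (hx : x ∈ cellSlab R R') (hgx : g • x ∈ cellSlab R R') : g = 1 := by
  simp only [cellSlab, Set.mem_setOf_eq, CShift.smul_def, Matrix.cons_val_zero, Matrix.cons_val_one,
    Matrix.cons_val] at hx hgx
  have hb : |(M : ℤ) * g.exp| ≤ (2 * R' : ℕ) := by
    have e : (M : ℤ) * g.exp = (x.1 2 + M * g.exp) - x.1 2 := by ring
    rw [e]; push_cast
    exact (abs_sub _ _).trans (by linarith [hx.2.2, hgx.2.2])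
  exact CShift.exp_injective (by simpa using exp_eq_zero_of_abs_mul_le hM hb)

/-- (ii) for cell-slabs: once `M > R + 2R'`. [folklore] -/
theorem cellSlab_no_edge {M R R' : ℕ} (hM : R + 2 * R' < M) (g : CShift M) (x y : HV2)
    (hx : x ∈ cellSlab R R') (hy : y ∈ cellSlab R R') (h : heisenbergZ2Graph.Adj x (g • y)) : g = 1 := by
  simp only [cellSlab, Set.mem_setOf_eq] at hx hy
  rw [hz2_adj, CShift.smul_def] at h
  have hb : |(M : ℤ) * g.exp| ≤ (R + 2 * R' : ℕ) := by
    rcases h with ⟨ha, -⟩ | ⟨-, hu⟩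
    · have h1 := heis_adj_abs_sub_two_le ha
      simp only [Matrix.cons_val] at h1
      have e : (M : ℤ) * g.exp = (y.1 2 + M * g.exp - x.1 2) + (x.1 2 - y.1 2) := by ring
      rw [e]; push_cast
      refine (abs_add_le _ _).trans ?_
      have := abs_sub (x.1 2) (y.1 2)
      linarith [hx.1, hx.2.2, hy.2.2]
    · have h2 := congrFun hu 2
      simp only [Matrix.cons_val] at h2
      have e : (M : ℤ) * g.exp = x.1 2 - y.1 2 := by linarith
      rw [e]; push_cast
      exact (abs_sub _ _).trans (by linarith [hx.2.2, hy.2.2])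
  exact CShift.exp_injective (by simpa using exp_eq_zero_of_abs_mul_le hM hb)

/-! ## The two Martineau–Severo devices of rung R2c, for `X = H₃` -/

/-- **Tubes are strictly subcritical at `p_c(G₂)`:** `p_c(G₂) < p_c(G₂[H₃ × {|u₀| ≤ ℓ}])` for every `ℓ`.
[cite: MartineauSevero2019, Cor. 2.2] -/
theorem criticalProb_lt_criticalProb_tube (ℓ : ℕ) :
    criticalProb heisenbergZ2Graph (0, 0) <
      criticalProb (heisenbergZ2Graph.induce (tube ℓ)) ⟨(0, 0), zero_mem_tube ℓ⟩ := by
  have hM : (2 * ℓ + 2) ≠ 0 := by omega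
  exact QuotientSlab.criticalProb_lt_criticalProb_induce_of_quotient (Γ := TShift (2 * ℓ + 2))
    heisenbergZ2Graph (tshift_isActionByAut _) (tshift_free hM) hz2_connected hz2_quasiTransitive
    (tquot_quasiTransitive _) (tube_orbit_once (by omega)) (tube_no_edge (by omega)) (0, 0)
    (zero_mem_tube ℓ) criticalProb_hz2_lt_one

/-- **Cell-slabs are strictly subcritical at `p_c(G₂)`** ((D5) on this rung):
`p_c(G₂) < p_c(G₂[B_{R,R'} × ℤ²])` for every `R, R'`. [cite: MartineauSevero2019, Cor. 2.2] -/
theorem criticalProb_lt_criticalProb_cellSlab (R R' : ℕ) :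
    criticalProb heisenbergZ2Graph (0, 0) <
      criticalProb (heisenbergZ2Graph.induce (cellSlab R R')) ⟨(0, 0), zero_mem_cellSlab R R'⟩ := by
  have hM : (R + 2 * R' + 1) ≠ 0 := by omega
  exact QuotientSlab.criticalProb_lt_criticalProb_induce_of_quotient (Γ := CShift (R + 2 * R' + 1))
    heisenbergZ2Graph (cshift_isActionByAut _) (cshift_free hM) hz2_connected hz2_quasiTransitive
    (cquot_quasiTransitive _) (cellSlab_orbit_once (by omega)) (cellSlab_no_edge (by omega)) (0, 0)
    (zero_mem_cellSlab R R') criticalProb_hz2_lt_one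

/-- No tube percolates at `p_c(G₂)`. [cite: MartineauSevero2019, Cor. 2.2] -/
theorem theta_tube_criticalProb_eq_zero (ℓ : ℕ) :
    theta (heisenbergZ2Graph.induce (tube ℓ)) ⟨(0, 0), zero_mem_tube ℓ⟩
      (criticalProbIOf heisenbergZ2Graph (0, 0)) = 0 :=
  theta_eq_zero_of_lt_criticalProb_holds _ _ _ (criticalProb_lt_criticalProb_tube ℓ)

/-- No cell-slab percolates at `p_c(G₂)` ((D5) on this rung). [cite: MartineauSevero2019, Cor. 2.2] -/
theorem theta_cellSlab_criticalProb_eq_zero (R R' : ℕ) :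
    theta (heisenbergZ2Graph.induce (cellSlab R R')) ⟨(0, 0), zero_mem_cellSlab R R'⟩
      (criticalProbIOf heisenbergZ2Graph (0, 0)) = 0 :=
  theta_eq_zero_of_lt_criticalProb_holds _ _ _ (criticalProb_lt_criticalProb_cellSlab R R')

/-! ## Targets and the assembly on this rung -/

/-- TARGET (Benjamini–Schramm Conj. 4 for `Cay(H₃(ℤ) × ℤ²)`): `θ_{G₂}(p_c(G₂)) = 0`.  OPEN.
[cite: BenjaminiSchramm1996, Conj. 4] -/
@[conjecture]
def HeisenbergZ2CriticalContinuity : Prop :=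
  theta heisenbergZ2Graph (0, 0) (criticalProbIOf heisenbergZ2Graph (0, 0)) = 0

/-- TARGET (D1–D4) on rung R2c for `X = H₃` — the Kozma–Nitzan §4 analogue with `X`-thick cells:
an infinite cluster at `p` forces some cell-slab `B_{R,R'} × ℤ²` to percolate at the same `p`.  To be proved
from `AdditiveGluing` (p205010) by the KN exploration on the `ℤ²` factor (interface (I-c), LADDER R2c).
Not in print. [cite: KozmaNitzan2024, §4] -/
@[conjecture]
def HeisenbergZ2CellSlabPercolation : Prop :=
  ∀ p : unitInterval, 0 < theta heisenbergZ2Graph (0, 0) p →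
    ∃ R R' : ℕ, 0 < theta (heisenbergZ2Graph.induce (cellSlab R R')) ⟨(0, 0), zero_mem_cellSlab R R'⟩ p

/-- **KN Theorem 6 on rung R2c, `X = H₃`: the same-`p` cell-slab statement ALONE gives `θ(p_c) = 0`**
((D5) being the kernel theorem `theta_cellSlab_criticalProb_eq_zero`). [cite: KozmaNitzan2024, Thm. 6] -/
theorem continuity_of_cellSlabPercolation (h : HeisenbergZ2CellSlabPercolation) :
    HeisenbergZ2CriticalContinuity := by
  unfold HeisenbergZ2CriticalContinuity
  by_contra hne
  have hpos : 0 < theta heisenbergZ2Graph (0, 0) (criticalProbIOf heisenbergZ2Graph (0, 0)) :=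
    lt_of_le_of_ne measureReal_nonneg (Ne.symm hne)
  obtain ⟨R, R', hR⟩ := h _ hpos
  rw [theta_cellSlab_criticalProb_eq_zero R R'] at hR
  exact lt_irrefl _ hR

end Summit.CriticalPhenomena.PercolationContinuityZ3.Theorems.HeisenbergZ2
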